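import Summits.CriticalPhenomena.PercolationContinuityZ3.Theorems.PercNearOneGluingNoHeavyLowerTailKnQuestion8PocketOddsExchange
import HarnessLib

/-!
# KN Question 8 / MC-D at three relays — superadditivity of the pocket odds, II: the `y↔z` worlds (Step 1)

Support file (`--supports stmt-CriticalPhenomena-4575`, closed), prover `prim-lf-2` (gen 19).  No definitions, no named facts, no sorries;
standard axioms.  Memo `prim-lf-2/PXI-gen19.md` §0(2), §3.3.  Part II of three (I: `…PocketOddsExchange.lean`, III: `…PocketOdds.lean`).

Setting (memos POCKET-CERT-gen16 §1, PXI-gen19 §0): one finite weighted graph, observer `o`, relays `x, y` and the designated relay `z`,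
a down-closed pocket family `𝒟` of vertex sets (none containing the relays, as needed), pocket event `P = {C_o ∈ 𝒟}`.  With
`E1 = {x↮y} ∩ {x↮z}`, `E2 = {y↮x} ∩ {y↮z}`, `F = {x↔y} ∩ {x↮z}` and the O:P likelihood ratios
`r_x = μ({x↔o} ∩ E1)/μ(P ∩ E1)`, `r_y = μ({y↔o} ∩ E2)/μ(P ∩ E2)`, `r_xy = μ({x↔o} ∩ F)/μ(P ∩ F)`, the inequality
  **(club)  `r_xy ≥ r_x + r_y`**   ("superadditivity of the pocket odds")
is the instance `U = {y ∈ C_x}` of the pair-functional pocket covariance comparison PCOV^ξ (memo PXI-gen19 §0(1)); equivalently the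
instance `G = 1{y ∈ ·}` of PCOV (prim-lf-2 gen 16/17; tree `PocketCert.block41_three_of_pcovZ`).  prim-lf-2 gen 19 census: 1 174/1 174,
sharp (ratio up to 0.9993).  Its proof has three steps, all positive association of a SET cluster (vdBHK Thm 2.1) in exchange form:
EXCH-X (`S = {x,y,o}`, `T = {z}`), Step 1 for `(x,y)` and for `(y,x)` (`S = {y,z}`, `T = {x,o}` after exploring `C_S`, vdBHK Lemma 2.4 =
tree `PocketCert.tower_setCl`), and the mediant inequality.
THIS FILE:
* `PocketCert.pocket_step1` — with `X = {u↮v} ∩ {u↮z} ∩ {v↮z}`, `X₁ = {u↮v} ∩ {u↮z} ∩ {v↔z}`: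
  `μ({u↔o}∩X₁) · μ(P∩X) ≤ μ(P∩X₁) · μ({u↔o}∩X)` — the O:P odds are smaller in the worlds where the two other relays are joined.
  Explore the cluster of `S = {v,z}` on `{S ↮ {u,o}}` (`tower_setCl`): the fresh probability of `{o ∈ C_u}` off the explored set is
  antitone in it, that of `P` is monotone (`𝒟` down-closed), `1{v↔z}` is increasing; positive association of `C_S` given `S ↮ {u,o}`
  (vdBHK Thm 2.1) in exchange form (`exch_of_pa`).
[cite: VandenbergHaggstromKahn2005, Thm. 2.1 (p. 9), §2.1 Lemma 2.4 (p. 10)] [cite: KozmaNitzan2024, Questions 8–9 (§5.5 p. 36)]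
-/

namespace Summit.CriticalPhenomena.PercolationContinuityZ3.Theorems

open MeasureTheory Set Literature.Probability.LatticeModels Literature.Probability.Percolation
open scoped Classical
open KNPreFKG BHK2006

noncomputable section

namespace PocketCert

variable {V : Type*} [Fintype V]

/-- **Step 1 (the `y↔z` worlds carry smaller O:P odds than the separated worlds).**  `𝒟` down-closed with `v`, `z` in no member,
`P = {C_o ∈ 𝒟}`; `X = {u↮v} ∩ {u↮z} ∩ {v↮z}`, `X₁ = {u↮v} ∩ {u↮z} ∩ {v↔z}`:
`μ({u↔o} ∩ X₁) · μ(P ∩ X) ≤ μ(P ∩ X₁) · μ({u↔o} ∩ X)`.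
Proof: explore the cluster of the set `S = {v, z}` on `{S ↮ {u, o}}` (vdBHK Lemma 2.4, tree `tower_setCl`): given it, the
conditional probability of `{o ∈ C_u}` is the fresh probability off the pairs meeting `S ∪ V(C_S)` — antitone in `C_S` — and that
of `P` is monotone in `C_S` (`𝒟` is down-closed); `1{v↔z}` is increasing in `C_S`; conclude by positive association of `C_S` given
`S ↮ {u,o}` (vdBHK Thm 2.1) in exchange form (`exch_of_pa`).
[cite: VandenbergHaggstromKahn2005, Thm. 2.1 (p. 9), §2.1 Lemma 2.4 (p. 10)] [cite: KozmaNitzan2024, Questions 8–9 (§5.5 p. 36)] -/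
theorem pocket_step1 (w : Sym2 V → unitInterval) (o u v z : V) (𝒟 : Set (Set V)) (h𝒟 : IsLowerSet 𝒟)
    (hv : ∀ W ∈ 𝒟, v ∉ W) (hz : ∀ W ∈ 𝒟, z ∉ W) :
    (prodBernoulli w).real (openConn u o ∩ ({ω | ¬ (openGraph ω).Reachable u v} ∩ {ω | ¬ (openGraph ω).Reachable u z} ∩
          openConn v z)) *
        (prodBernoulli w).real ({ω : BondConfig V | openCluster ω o ∈ 𝒟} ∩ ({ω | ¬ (openGraph ω).Reachable u v} ∩
          {ω | ¬ (openGraph ω).Reachable u z} ∩ {ω | ¬ (openGraph ω).Reachable v z})) ≤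
      (prodBernoulli w).real ({ω : BondConfig V | openCluster ω o ∈ 𝒟} ∩ ({ω | ¬ (openGraph ω).Reachable u v} ∩
          {ω | ¬ (openGraph ω).Reachable u z} ∩ openConn v z)) *
        (prodBernoulli w).real (openConn u o ∩ ({ω | ¬ (openGraph ω).Reachable u v} ∩ {ω | ¬ (openGraph ω).Reachable u z} ∩
          {ω | ¬ (openGraph ω).Reachable v z})) := by
  classical
  set μ := prodBernoulli w with hμ
  have hmeas : ∀ S' : Set (BondConfig V), MeasurableSet S' := fun _ => MeasurableSet.of_discrete
  have hn := fun (S' : Set (BondConfig V)) => (measureReal_nonneg : 0 ≤ μ.real S')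
  set S : Set V := {v, z} with hS
  set T : Set V := {u, o} with hT
  set D : Set (BondConfig V) := {ω : BondConfig V | ∀ s ∈ S, ∀ t ∈ T, ¬ (openGraph ω).Reachable s t} with hD
  set P : Set (BondConfig V) := {ω : BondConfig V | openCluster ω o ∈ 𝒟} with hP
  set Aev : Set (BondConfig V) := openConn v z with hAev
  set X : Set (BondConfig V) := {ω | ¬ (openGraph ω).Reachable u v} ∩ {ω | ¬ (openGraph ω).Reachable u z} ∩
      {ω | ¬ (openGraph ω).Reachable v z} with hX
  set X1 : Set (BondConfig V) := {ω | ¬ (openGraph ω).Reachable u v} ∩ {ω | ¬ (openGraph ω).Reachable u z} ∩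
      openConn v z with hX1
  have hvS : v ∈ S := by simp [hS]
  have hzS : z ∈ S := by simp [hS]
  have hsc : ∀ ω : BondConfig V, (⋃ s ∈ S, openEdgeCluster ω s) = setCl ω S := fun ω => rfl
  -- the fresh conditional probabilities as functions of the edge cluster `C` of `S`
  set kO : Set (Sym2 V) → ℝ := fun C => ∫ η, (openCluster (η \ barOf S C) u).indicator (1 : V → ℝ) o ∂μ with hkO
  set kP : Set (Sym2 V) → ℝ := fun C => ∫ η, (if openCluster (η \ barOf S C) o ∈ 𝒟 then (1 : ℝ) else 0) ∂μ with hkP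
  set GA : Set (Sym2 V) → ℝ := fun C => (openCluster C v).indicator (1 : V → ℝ) z with hGA
  have hkO_anti : Antitone kO := by
    intro C C' hCC'
    simp only [hkO]
    refine integral_mono (Integrable.of_finite) (Integrable.of_finite) fun η => ?_
    have hsub : openCluster (η \ barOf S C') u ⊆ openCluster (η \ barOf S C) u :=
      openCluster_mono (sdiff_subset_sdiff_right (barOf_mono S hCC')) u
    exact Set.indicator_le_indicator_of_subset hsub (fun _ => zero_le_one) o
  have hkP_mono : Monotone kP := by
    intro C C' hCC'
    simp only [hkP]
    refine integral_mono (Integrable.of_finite) (Integrable.of_finite) fun η => ?_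
    have hsub : openCluster (η \ barOf S C') o ⊆ openCluster (η \ barOf S C) o :=
      openCluster_mono (sdiff_subset_sdiff_right (barOf_mono S hCC')) o
    by_cases h : openCluster (η \ barOf S C) o ∈ 𝒟
    · rw [if_pos h, if_pos (h𝒟 hsub h)]
    · rw [if_neg h]; split_ifs <;> norm_num
  have hF1_mono : Monotone (fun C => 1 - kO C) := fun C C' hCC' => by
    simp only; linarith [hkO_anti hCC']
  have hGA_mono : Monotone GA := by
    intro C C' hCC'
    simp only [hGA]
    by_cases h : z ∈ openCluster C v
    · rw [indicator_of_mem h, indicator_of_mem (openCluster_mono hCC' v h)]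
    · rw [indicator_of_notMem h]
      by_cases h' : z ∈ openCluster C' v
      · rw [indicator_of_mem h']; simp
      · rw [indicator_of_notMem h']
  have hclv : ∀ ω : BondConfig V, openCluster (setCl ω S) v = openCluster ω v := by
    intro ω; ext a; exact (KNSep.reachable_iff_cluster ω S hvS a).symm
  have hGA_eq : ∀ ω : BondConfig V, GA (setCl ω S) = Aev.indicator 1 ω := by
    intro ω; simp only [hGA, hclv ω]
    by_cases h : (openGraph ω).Reachable v z
    · rw [indicator_of_mem (show z ∈ openCluster ω v from h), indicator_of_mem (show ω ∈ Aev from h)]; simp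
    · rw [indicator_of_notMem (show z ∉ openCluster ω v from h), indicator_of_notMem (show ω ∉ Aev from h)]
  -- reading reachability from vertices of `S` off `setCl ω S`
  have hrv : ∀ (ω : BondConfig V) (a : V), (openGraph (setCl ω S)).Reachable v a ↔ (openGraph ω).Reachable v a :=
    fun ω a => (KNSep.reachable_iff_cluster ω S hvS a).symm
  have hrz : ∀ (ω : BondConfig V) (a : V), (openGraph (setCl ω S)).Reachable z a ↔ (openGraph ω).Reachable z a :=
    fun ω a => (KNSep.reachable_iff_cluster ω S hzS a).symm
  have hDmem : ∀ ω : BondConfig V, ω ∈ D ↔ (¬ (openGraph ω).Reachable v u ∧ ¬ (openGraph ω).Reachable v o) ∧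
      (¬ (openGraph ω).Reachable z u ∧ ¬ (openGraph ω).Reachable z o) := by
    intro ω
    simp only [hD, hS, hT, mem_setOf_eq, mem_insert_iff, mem_singleton_iff, forall_eq_or_imp, forall_eq]
  -- (a) positive association of `kP(C_S)` and `1{v↔z}` given `D`
  have ha := BHK2006_setClusterConditionalPositiveAssociation w S T kP GA hkP_mono hGA_mono
  simp_rw [hsc, hGA_eq] at ha
  rw [setIntegral_indicator_one_eq μ D Aev, setIntegral_mul_indicator_one μ D Aev] at ha
  -- ha : (∫_D kP∘setCl) * μ(D∩Aev) ≤ μ D * ∫_{D∩Aev} kP∘setCl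
  -- (b) positive association of `1 − kO(C_S)` and `1{v↔z}` given `D`
  have hb := BHK2006_setClusterConditionalPositiveAssociation w S T (fun C => 1 - kO C) GA hF1_mono hGA_mono
  simp_rw [hsc, hGA_eq] at hb
  rw [setIntegral_indicator_one_eq μ D Aev, setIntegral_mul_indicator_one μ D Aev] at hb
  have ib1 : ∫ ω in D, (1 - kO (setCl ω S)) ∂μ = μ.real D - ∫ ω in D, kO (setCl ω S) ∂μ := by
    rw [integral_sub (Integrable.of_finite) (Integrable.of_finite), setIntegral_const, smul_eq_mul, mul_one]
  have ib2 : ∫ ω in D ∩ Aev, (1 - kO (setCl ω S)) ∂μ = μ.real (D ∩ Aev) - ∫ ω in D ∩ Aev, kO (setCl ω S) ∂μ := by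
    rw [integral_sub (Integrable.of_finite) (Integrable.of_finite), setIntegral_const, smul_eq_mul, mul_one]
  rw [ib1, ib2] at hb
  -- hb : (μD − ∫_D kO)(μ(D∩Aev)) ≤ μD (μ(D∩Aev) − ∫_{D∩Aev} kO)
  -- split the integrals over `D` along `Aev`
  have sP : ∫ ω in D, kP (setCl ω S) ∂μ = (∫ ω in D ∩ Aev, kP (setCl ω S) ∂μ) + ∫ ω in D \ Aev, kP (setCl ω S) ∂μ :=
    (integral_inter_add_sdiff (hmeas Aev) (Integrable.of_finite).integrableOn).symm
  have sO : ∫ ω in D, kO (setCl ω S) ∂μ = (∫ ω in D ∩ Aev, kO (setCl ω S) ∂μ) + ∫ ω in D \ Aev, kO (setCl ω S) ∂μ :=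
    (integral_inter_add_sdiff (hmeas Aev) (Integrable.of_finite).integrableOn).symm
  -- the four tower identifications
  -- (T1) ∫_{D∩Aev} kP = μ(P ∩ X1)
  set F𝒟 : Set V → ℝ := fun K => if K ∈ 𝒟 then 1 else 0 with hF𝒟
  have tP : ∀ (𝒮 : Set (Set (Sym2 V))),
      ∫ ω in {ω : BondConfig V | ∀ s ∈ S, ¬ (openGraph ω).Reachable s o} ∩ {ω | setCl ω S ∈ 𝒮}, F𝒟 (openCluster ω o) ∂μ =
        ∫ ω in {ω : BondConfig V | ∀ s ∈ S, ¬ (openGraph ω).Reachable s o} ∩ {ω | setCl ω S ∈ 𝒮}, kP (setCl ω S) ∂μ :=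
    fun 𝒮 => tower_setCl w S o F𝒟 𝒮
  set FO : Set V → ℝ := fun K => K.indicator (1 : V → ℝ) o with hFO
  have tO : ∀ (𝒮 : Set (Set (Sym2 V))),
      ∫ ω in {ω : BondConfig V | ∀ s ∈ S, ¬ (openGraph ω).Reachable s u} ∩ {ω | setCl ω S ∈ 𝒮}, FO (openCluster ω u) ∂μ =
        ∫ ω in {ω : BondConfig V | ∀ s ∈ S, ¬ (openGraph ω).Reachable s u} ∩ {ω | setCl ω S ∈ 𝒮}, kO (setCl ω S) ∂μ :=
    fun 𝒮 => tower_setCl w S u FO 𝒮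
  -- the families of edge sets and the corresponding domains
  set 𝒮P1 : Set (Set (Sym2 V)) := {C | (openGraph C).Reachable v z ∧ ¬ (openGraph C).Reachable v u ∧
      ¬ (openGraph C).Reachable z u} with h𝒮P1
  set 𝒮P0 : Set (Set (Sym2 V)) := {C | ¬ (openGraph C).Reachable v z ∧ ¬ (openGraph C).Reachable v u ∧
      ¬ (openGraph C).Reachable z u} with h𝒮P0
  set 𝒮O1 : Set (Set (Sym2 V)) := {C | (openGraph C).Reachable v z ∧ ¬ (openGraph C).Reachable v o ∧
      ¬ (openGraph C).Reachable z o} with h𝒮O1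
  set 𝒮O0 : Set (Set (Sym2 V)) := {C | ¬ (openGraph C).Reachable v z ∧ ¬ (openGraph C).Reachable v o ∧
      ¬ (openGraph C).Reachable z o} with h𝒮O0
  have hDom : ∀ (a : V) (ω : BondConfig V), ω ∈ {ω : BondConfig V | ∀ s ∈ S, ¬ (openGraph ω).Reachable s a} ↔
      (¬ (openGraph ω).Reachable v a ∧ ¬ (openGraph ω).Reachable z a) := by
    intro a ω
    simp only [hS, mem_setOf_eq, mem_insert_iff, mem_singleton_iff, forall_eq_or_imp, forall_eq]
  have dP1 : {ω : BondConfig V | ∀ s ∈ S, ¬ (openGraph ω).Reachable s o} ∩ {ω | setCl ω S ∈ 𝒮P1} = D ∩ Aev := by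
    ext ω
    rw [mem_inter_iff, hDom o ω, mem_inter_iff, hDmem ω]
    simp only [mem_setOf_eq, h𝒮P1, hrv, hrz, hAev, openConn]
    tauto
  have dP0 : {ω : BondConfig V | ∀ s ∈ S, ¬ (openGraph ω).Reachable s o} ∩ {ω | setCl ω S ∈ 𝒮P0} = D \ Aev := by
    ext ω
    rw [mem_inter_iff, hDom o ω, mem_sdiff, hDmem ω]
    simp only [mem_setOf_eq, h𝒮P0, hrv, hrz, hAev, openConn]
    tauto
  have dO1 : {ω : BondConfig V | ∀ s ∈ S, ¬ (openGraph ω).Reachable s u} ∩ {ω | setCl ω S ∈ 𝒮O1} = D ∩ Aev := by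
    ext ω
    rw [mem_inter_iff, hDom u ω, mem_inter_iff, hDmem ω]
    simp only [mem_setOf_eq, h𝒮O1, hrv, hrz, hAev, openConn]
    tauto
  have dO0 : {ω : BondConfig V | ∀ s ∈ S, ¬ (openGraph ω).Reachable s u} ∩ {ω | setCl ω S ∈ 𝒮O0} = D \ Aev := by
    ext ω
    rw [mem_inter_iff, hDom u ω, mem_sdiff, hDmem ω]
    simp only [mem_setOf_eq, h𝒮O0, hrv, hrz, hAev, openConn]
    tauto
  -- left sides: indicator integrals
  have hF𝒟_eq : ∀ ω : BondConfig V, F𝒟 (openCluster ω o) = P.indicator 1 ω := by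
    intro ω; simp only [hF𝒟]
    by_cases h : openCluster ω o ∈ 𝒟
    · rw [if_pos h, indicator_of_mem (show ω ∈ P from h)]; simp
    · rw [if_neg h, indicator_of_notMem (show ω ∉ P from h)]
  have hFO_eq : ∀ ω : BondConfig V, FO (openCluster ω u) = (openConn u o).indicator 1 ω := by
    intro ω; simp only [hFO]
    by_cases h : (openGraph ω).Reachable u o
    · rw [indicator_of_mem (show o ∈ openCluster ω u from h), indicator_of_mem (show ω ∈ openConn u o from h)]; simp
    · rw [indicator_of_notMem (show o ∉ openCluster ω u from h), indicator_of_notMem (show ω ∉ openConn u o from h)]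
  have T1 : ∫ ω in D ∩ Aev, kP (setCl ω S) ∂μ = μ.real (P ∩ X1) := by
    have h := tP 𝒮P1
    rw [dP1] at h
    simp_rw [hF𝒟_eq] at h
    rw [setIntegral_indicator_one_eq μ (D ∩ Aev) P] at h
    rw [← h]
    congr 1
    ext ω
    simp only [mem_inter_iff, hDmem, hAev, hX1, hP, openConn, mem_setOf_eq]
    constructor
    · rintro ⟨⟨⟨⟨hvu, -⟩, hzu, -⟩, hvz⟩, hp⟩
      exact ⟨hp, ⟨fun h => hvu h.symm, fun h => hzu h.symm⟩, hvz⟩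
    · rintro ⟨hp, ⟨huv, huz⟩, hvz⟩
      exact ⟨⟨⟨⟨fun h => huv h.symm, fun h => hv _ hp h.symm⟩, fun h => huz h.symm, fun h => hz _ hp h.symm⟩, hvz⟩, hp⟩
  have T2 : ∫ ω in D \ Aev, kP (setCl ω S) ∂μ = μ.real (P ∩ X) := by
    have h := tP 𝒮P0
    rw [dP0] at h
    simp_rw [hF𝒟_eq] at h
    rw [setIntegral_indicator_one_eq μ (D \ Aev) P] at h
    rw [← h]
    congr 1
    ext ω
    simp only [mem_inter_iff, mem_sdiff, hDmem, hAev, hX, hP, openConn, mem_setOf_eq]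
    constructor
    · rintro ⟨⟨⟨⟨hvu, -⟩, hzu, -⟩, hvz⟩, hp⟩
      exact ⟨hp, ⟨fun h => hvu h.symm, fun h => hzu h.symm⟩, hvz⟩
    · rintro ⟨hp, ⟨huv, huz⟩, hvz⟩
      exact ⟨⟨⟨⟨fun h => huv h.symm, fun h => hv _ hp h.symm⟩, fun h => huz h.symm, fun h => hz _ hp h.symm⟩, hvz⟩, hp⟩
  have T3 : ∫ ω in D ∩ Aev, kO (setCl ω S) ∂μ = μ.real (openConn u o ∩ X1) := by
    have h := tO 𝒮O1
    rw [dO1] at h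
    simp_rw [hFO_eq] at h
    rw [setIntegral_indicator_one_eq μ (D ∩ Aev) (openConn u o)] at h
    rw [← h]
    congr 1
    ext ω
    simp only [mem_inter_iff, hDmem, hAev, hX1, openConn, mem_setOf_eq]
    constructor
    · rintro ⟨⟨⟨⟨hvu, -⟩, hzu, -⟩, hvz⟩, huo⟩
      exact ⟨huo, ⟨fun h => hvu h.symm, fun h => hzu h.symm⟩, hvz⟩
    · rintro ⟨huo, ⟨huv, huz⟩, hvz⟩
      exact ⟨⟨⟨⟨fun h => huv h.symm, fun h => huv (huo.trans h.symm)⟩, fun h => huz h.symm,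
        fun h => huz (huo.trans h.symm)⟩, hvz⟩, huo⟩
  have T4 : ∫ ω in D \ Aev, kO (setCl ω S) ∂μ = μ.real (openConn u o ∩ X) := by
    have h := tO 𝒮O0
    rw [dO0] at h
    simp_rw [hFO_eq] at h
    rw [setIntegral_indicator_one_eq μ (D \ Aev) (openConn u o)] at h
    rw [← h]
    congr 1
    ext ω
    simp only [mem_inter_iff, mem_sdiff, hDmem, hAev, hX, openConn, mem_setOf_eq]
    constructor
    · rintro ⟨⟨⟨⟨hvu, -⟩, hzu, -⟩, hvz⟩, huo⟩
      exact ⟨huo, ⟨fun h => hvu h.symm, fun h => hzu h.symm⟩, hvz⟩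
    · rintro ⟨huo, ⟨huv, huz⟩, hvz⟩
      exact ⟨⟨⟨⟨fun h => huv h.symm, fun h => huv (huo.trans h.symm)⟩, fun h => huz h.symm,
        fun h => huz (huo.trans h.symm)⟩, hvz⟩, huo⟩
  rw [sP, T1, T2] at ha
  rw [sO, T3, T4] at hb
  have hAle : μ.real (openConn u o ∩ X1) ≤ μ.real (D ∩ Aev) := by
    refine measureReal_mono ?_
    rintro ω ⟨huo, ⟨huv, huz⟩, hvz⟩
    exact ⟨(hDmem ω).2 ⟨⟨fun h => huv h.symm, fun h => huv (huo.trans h.symm)⟩, fun h => huz h.symm,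
      fun h => huz (huo.trans h.symm)⟩, hvz⟩
  have key := exch_of_pa (μ.real D) (μ.real (D ∩ Aev)) (μ.real (P ∩ X1)) (μ.real (P ∩ X))
    (μ.real (openConn u o ∩ X1)) (μ.real (openConn u o ∩ X)) (hn _) (hn _) (hn _) (hn _) hAle ha (by nlinarith [hb])
  -- key : μ(O∩X1) * μ(P∩X) ≤ μ(P∩X1) * μ(O∩X)
  exact key


end PocketCert

end

end Summit.CriticalPhenomena.PercolationContinuityZ3.Theorems
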